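import Summits.SmoothPoincare4.SmoothPoincare4.Theorems.SblfDescentRungOneHelperDxTransfer
import HarnessLib

/-!
# Disc extension, layer 8: the tube slice of a matched level circle

Auxiliary file of helper `helper_sliceGluing_discExtension` (apex leaf DX: extension of the
torus angular coordinate over the torus disc), line `Sketch`, crux `SblfDescent.RungOne`.

(Crux item stmt-SmoothPoincare4-18531; skeleton `Cruxes/RungOne/Lines/Sketch.lean`.)

The extra conjunct of the brick: on the shell where the angular map `Aext` is the rigid collar
coordinate `aC`, a point `z` in the fibre of a tube point `ν (u, x)` with the same value of `Aext`
lies in the tube slice `ν ({u} × B(0, ε₂))`.  Indeed `z = ιC ((aC z, bC z), (u, s))`,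
`s = Q(x)`, and the level circle `{aC = aC z}` of that fibre is swept out by `ν (u, ·)` along the
circle `c ↦ (ρ c, x₂)`, `ρ = √(s + x₂²)` (same depth `x₂`, same `Q = s`, same norm `‖x‖`):
`c ↦ bC (ν (u, (ρ c, x₂)))` is a continuous injective self-map of `𝕊¹`, hence onto
(`surjective_of_continuous_of_injective_circle`, from compactness and connectedness of the
circle and of the circle minus a point).  Everything is folklore topology.
-/

set_option linter.dupNamespace false

noncomputable section

open scoped Manifold ContDiff Topology Real
open Set Function Metric Literature.Topology.FourManifolds

namespace Summit.SmoothPoincare4.SmoothPoincare4.Cruxes.RungOne.Sketch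

namespace DiscExt

/-- Local notation: `𝔼 n` is the model Euclidean space `EuclideanSpace ℝ (Fin n)`. -/
local notation "𝔼 " n:arg => EuclideanSpace ℝ (Fin n)

/-- Local notation: `𝕊¹`, the unit circle of `ℝ²`. -/
local notation "𝕊¹" => (Metric.sphere (0 : EuclideanSpace ℝ (Fin 2)) (1 : ℝ))

/-- Local notation: `𝕊²`, the unit sphere of `ℝ³`. -/
local notation "𝕊²" => (Metric.sphere (0 : EuclideanSpace ℝ (Fin 3)) (1 : ℝ))

attribute [local instance] Literature.Topology.FourManifolds.fact_finrank_euclideanSpace_succ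

/-! ### Continuous injective self-maps of the circle are onto -/

/-- The circle minus a point is connected (it is a chart domain homeomorphic to `ℝ`). [folklore] -/
theorem isConnected_compl_singleton_circle (p : 𝕊¹) : IsConnected ({p}ᶜ : Set 𝕊¹) := by
  set e := stereographic' 1 p with he
  have hsrc : e.source = {p}ᶜ := stereographic'_source p
  have htgt : e.target = univ := stereographic'_target p
  rw [← hsrc, ← e.symm_image_target_eq_source, htgt]
  exact (isConnected_univ (α := 𝔼 1)).image _ (by rw [← htgt]; exact e.continuousOn_symm)

/-- The circle is connected. [folklore] -/
theorem isPreconnected_univ_circle : IsPreconnected (univ : Set 𝕊¹) := by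
  have h : IsConnected (Metric.sphere (0 : 𝔼 2) 1) :=
    isConnected_sphere (by rw [← Module.finrank_eq_rank]; simp) (0 : 𝔼 2) zero_le_one
  haveI := isConnected_iff_connectedSpace.1 h
  exact isPreconnected_univ

/-- **A continuous injective self-map of the circle is surjective.** If a point `y₀` is missed,
the map factors through the chart at `y₀`, i.e. gives a continuous injection `𝕊¹ → ℝ`; its image
is an interval `[m, M]` with `m < M`, and removing the (unique) preimage of an interior value
disconnects the image although `𝕊¹` minus a point is connected. [folklore] -/
theorem surjective_of_continuous_of_injective_circle {φ : 𝕊¹ → 𝕊¹} (hc : Continuous φ)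
    (hi : Injective φ) : Surjective φ := by
  intro y₀
  by_contra hy
  push Not at hy
  set e := stereographic' 1 y₀ with he
  have hsrc : ∀ x, φ x ∈ e.source := fun x ↦ by
    rw [stereographic'_source]; exact hy x
  -- the real-valued function `g x = (e (φ x))₀`
  set gf : 𝕊¹ → ℝ := fun x ↦ (e (φ x)) 0 with hgf
  have hgc : Continuous gf := by
    have h1 : Continuous (e ∘ φ) := e.continuousOn.comp_continuous hc hsrc
    exact (EuclideanSpace.proj (𝕜 := ℝ) (0 : Fin 1)).continuous.comp h1
  have hgi : Injective gf := by
    intro x x' h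
    have h1 : e (φ x) = e (φ x') := by
      ext i
      fin_cases i
      exact h
    exact hi (e.injOn (hsrc x) (hsrc x') h1)
  -- min and max
  obtain ⟨pm, -, hpm⟩ := isCompact_univ.exists_isMinOn univ_nonempty hgc.continuousOn
  obtain ⟨pM, -, hpM⟩ := isCompact_univ.exists_isMaxOn univ_nonempty hgc.continuousOn
  rw [isMinOn_iff] at hpm
  rw [isMaxOn_iff] at hpM
  have hne : pm ≠ pM := by
    intro h
    have hconst : ∀ x, gf x = gf pm := fun x ↦
      le_antisymm (by rw [h]; exact hpM x (mem_univ _)) (hpm x (mem_univ _))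
    exact ptA_ne_ptB (hgi ((hconst ptA).trans (hconst ptB).symm))
  have hlt : gf pm < gf pM := lt_of_le_of_ne (hpm pM (mem_univ _)) fun h ↦ hne (hgi h)
  -- an interior value is attained at a unique point `p`
  obtain ⟨p, -, hp⟩ : (gf pm + gf pM) / 2 ∈ gf '' univ :=
    (isPreconnected_univ_circle.image gf hgc.continuousOn).Icc_subset (mem_image_of_mem _ (mem_univ pm))
      (mem_image_of_mem _ (mem_univ pM)) ⟨by linarith, by linarith⟩
  have hpm' : pm ∈ ({p}ᶜ : Set 𝕊¹) := by
    intro h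
    rw [mem_singleton_iff] at h
    rw [← h] at hp; linarith
  have hpM' : pM ∈ ({p}ᶜ : Set 𝕊¹) := by
    intro h
    rw [mem_singleton_iff] at h
    rw [← h] at hp; linarith
  -- the image of the punctured circle is an interval containing that value: contradiction
  obtain ⟨q, hq, hq'⟩ : (gf pm + gf pM) / 2 ∈ gf '' ({p}ᶜ : Set 𝕊¹) :=
    ((isConnected_compl_singleton_circle p).isPreconnected.image gf hgc.continuousOn).Icc_subset
      (mem_image_of_mem _ hpm') (mem_image_of_mem _ hpM') ⟨by linarith, by linarith⟩
  exact hq (hgi (hq'.trans hp.symm))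

/-! ### The tube slice of a level circle -/

section Setup

variable {X : Type} [TopologicalSpace X] [ChartedSpace (𝔼 4) X]
  {Fb : Type} [TopologicalSpace Fb] [ChartedSpace (𝔼 2) Fb] [Nonempty Fb]
  {f : X → 𝕊²} {v : 𝕊²} {ιT : Fb × 𝔼 2 → X}
  {ν : 𝕊¹ × 𝔼 3 → X} {σ ε : ℝ} {g : ℝ → ℝ} {s₁ s₂ ε₂ : ℝ}
  {ιC : (𝕊¹ × 𝕊¹) × (𝕊¹ × ℝ) → X} {aC bC : X → 𝕊¹}
  {Acirc : Fb × 𝔼 2 → Circle} {a d : ℝ}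

omit [Nonempty Fb] in
/-- **Pinning the longitude**: if `f (ιC ((a, b), (u', s)))` has planar part `√(1 - s²) u`, then
`u' = u` (for `s² < 1`). [folklore] -/
theorem pin_longitude (hC : IsRigidCollar f v ν σ g s₁ s₂ ε₂ ιC aC bC) {s : ℝ} (h1 : s₁ < s)
    (h2 : s < s₂) (hs : s ^ 2 < 1) {a' b' u u' : 𝕊¹}
    (e0 : ((f (ιC ((a', b'), (u', s))) : 𝕊²) : 𝔼 3) 0 = √(1 - s ^ 2) * (u : 𝔼 2) 0)
    (e1 : ((f (ιC ((a', b'), (u', s))) : 𝕊²) : 𝔼 3) 1 = √(1 - s ^ 2) * (u : 𝔼 2) 1) : u' = u := by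
  obtain ⟨f0, f1, -, -, -⟩ := hC.formula a' b' u' s h1 h2
  have hne : √(1 - s ^ 2) ≠ 0 := (Real.sqrt_pos.2 (by linarith)).ne'
  apply Subtype.ext
  ext i
  fin_cases i
  · exact mul_left_cancel₀ hne (f0.symm.trans e0)
  · exact mul_left_cancel₀ hne (f1.symm.trans e1)

omit [Nonempty Fb] in
/-- **A band point in rigid coordinates with pinned longitude**: if `h x = s ∈ (s₁, s₂)`, `s² < 1`
and `f x` has planar part `√(1 - s²) u`, then `ιC ((aC x, bC x), (u, s)) = x`. [folklore] -/
theorem ιC_section_pinned (hC : IsRigidCollar f v ν σ g s₁ s₂ ε₂ ιC aC bC) {x : X} {s : ℝ}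
    (hx : hgt f v x = s) (h1 : s₁ < s) (h2 : s < s₂) (hs : s ^ 2 < 1) {u : 𝕊¹}
    (e0 : ((f x : 𝕊²) : 𝔼 3) 0 = √(1 - s ^ 2) * (u : 𝔼 2) 0)
    (e1 : ((f x : 𝕊²) : 𝔼 3) 1 = √(1 - s ^ 2) * (u : 𝔼 2) 1) : ιC ((aC x, bC x), (u, s)) = x := by
  have hx' : (v : 𝔼 3) 2 * ((f x : 𝕊²) : 𝔼 3) 2 = s := hx
  obtain ⟨u', hu'⟩ := hC.section_eq x (by rw [hx']; exact h1) (by rw [hx']; exact h2)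
  rw [hx'] at hu'
  have hu : u' = u := pin_longitude hC h1 h2 hs (by rw [hu']; exact e0) (by rw [hu']; exact e1)
  rw [← hu]; exact hu'

omit [Nonempty Fb] in
/-- The planar part of `f` along the fold tube: `(f (ν (u, x)))ᵢ = √(1 - Q²) uᵢ`. [folklore] -/
theorem f_ν_planar (hF : IsFoldTube f v ε ν) (u : 𝕊¹) {x : 𝔼 3} (hx : x ∈ ball (0 : 𝔼 3) ε) :
    ((f (ν (u, x)) : 𝕊²) : 𝔼 3) 0 = √(1 - (x 0 ^ 2 + x 1 ^ 2 - x 2 ^ 2) ^ 2) * (u : 𝔼 2) 0 ∧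
    ((f (ν (u, x)) : 𝕊²) : 𝔼 3) 1 = √(1 - (x 0 ^ 2 + x 1 ^ 2 - x 2 ^ 2) ^ 2) * (u : 𝔼 2) 1 :=
  ⟨(hF.formula u x hx).1, (hF.formula u x hx).2.1⟩

/-- **The level circle in the tube**: the point `(ρ c₀, ρ c₁, x₂)` of `ℝ³` for `c ∈ 𝕊¹`,
`ρ = √(Q(x) + x₂²)`. [folklore] -/
def levelPt (x : 𝔼 3) (c : 𝕊¹) : 𝔼 3 :=
  (EuclideanSpace.equiv (Fin 3) ℝ).symm
    ![√(x 0 ^ 2 + x 1 ^ 2) * (c : 𝔼 2) 0, √(x 0 ^ 2 + x 1 ^ 2) * (c : 𝔼 2) 1, x 2]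

omit [Nonempty Fb] in
/-- Coordinates of `levelPt`. [folklore] -/
theorem levelPt_apply (x : 𝔼 3) (c : 𝕊¹) :
    levelPt x c 0 = √(x 0 ^ 2 + x 1 ^ 2) * (c : 𝔼 2) 0 ∧ levelPt x c 1 = √(x 0 ^ 2 + x 1 ^ 2) * (c : 𝔼 2) 1 ∧
      levelPt x c 2 = x 2 := by
  simp [levelPt]

omit [Nonempty Fb] in
/-- A point of `𝕊¹` has `c₀² + c₁² = 1`. [folklore] -/
theorem circle_coords_sq (c : 𝕊¹) : (c : 𝔼 2) 0 ^ 2 + (c : 𝔼 2) 1 ^ 2 = 1 := by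
  have h : ‖(c : 𝔼 2)‖ ^ 2 = 1 := by rw [norm_eq_of_mem_sphere c, one_pow]
  rw [EuclideanSpace.norm_sq_eq, Fin.sum_univ_two] at h
  simpa only [Real.norm_eq_abs, sq_abs] using h

omit [Nonempty Fb] in
/-- **`levelPt` has the same `Q` as `x`.** [folklore] -/
theorem Q_levelPt (x : 𝔼 3) (c : 𝕊¹) :
    levelPt x c 0 ^ 2 + levelPt x c 1 ^ 2 - levelPt x c 2 ^ 2 = x 0 ^ 2 + x 1 ^ 2 - x 2 ^ 2 := by
  obtain ⟨h0, h1, h2⟩ := levelPt_apply x c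
  rw [h0, h1, h2, mul_pow, mul_pow, ← mul_add, circle_coords_sq, mul_one, Real.sq_sqrt (by positivity)]

omit [Nonempty Fb] in
/-- **`levelPt` has the same norm as `x`.** [folklore] -/
theorem norm_levelPt (x : 𝔼 3) (c : 𝕊¹) : ‖levelPt x c‖ = ‖x‖ := by
  have h : ‖levelPt x c‖ ^ 2 = ‖x‖ ^ 2 := by
    rw [EuclideanSpace.norm_sq_eq, EuclideanSpace.norm_sq_eq, Fin.sum_univ_three, Fin.sum_univ_three]
    simp only [Real.norm_eq_abs, sq_abs]
    obtain ⟨h0, h1, h2⟩ := levelPt_apply x c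
    rw [h0, h1, h2, mul_pow, mul_pow, ← mul_add, circle_coords_sq, mul_one, Real.sq_sqrt (by positivity)]
  exact (sq_eq_sq₀ (norm_nonneg _) (norm_nonneg _)).1 h

omit [Nonempty Fb] in
/-- `levelPt x` is continuous in `c`. [folklore] -/
theorem continuous_levelPt (x : 𝔼 3) : Continuous (levelPt x) := by
  unfold levelPt
  refine (EuclideanSpace.equiv (Fin 3) ℝ).symm.continuous.comp ?_
  refine continuous_pi fun i ↦ ?_
  have hc0 : Continuous fun c : 𝕊¹ ↦ (c : 𝔼 2) 0 :=
    (EuclideanSpace.proj (𝕜 := ℝ) (0 : Fin 2)).continuous.comp continuous_subtype_val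
  have hc1 : Continuous fun c : 𝕊¹ ↦ (c : 𝔼 2) 1 :=
    (EuclideanSpace.proj (𝕜 := ℝ) (1 : Fin 2)).continuous.comp continuous_subtype_val
  fin_cases i
  · exact continuous_const.mul hc0
  · exact continuous_const.mul hc1
  · exact continuous_const

omit [Nonempty Fb] in
/-- `levelPt x` is injective when `x₀² + x₁² > 0`. [folklore] -/
theorem levelPt_injective {x : 𝔼 3} (hx : 0 < x 0 ^ 2 + x 1 ^ 2) : Injective (levelPt x) := by
  intro c c' h
  have hne : √(x 0 ^ 2 + x 1 ^ 2) ≠ 0 := (Real.sqrt_pos.2 hx).ne'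
  obtain ⟨h0, h1, -⟩ := levelPt_apply x c
  obtain ⟨h0', h1', -⟩ := levelPt_apply x c'
  apply Subtype.ext
  ext i
  fin_cases i
  · exact mul_left_cancel₀ hne (h0.symm.trans ((congrArg (· 0) h).trans h0'))
  · exact mul_left_cancel₀ hne (h1.symm.trans ((congrArg (· 1) h).trans h1'))

/-- **The tube slice of a matched level circle** (the extra conjunct of the brick): for
`x ∈ B(0, ε₂)` with `sA < Q(x) < sB` and `z` in the fibre of `ν (u, x)` with
`Aext z = Aext (ν (u, x))`, the point `z` lies in `ν ({u} × B(0, ε₂))`. [folklore] -/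
theorem slice_Aext (hT : IsTorusSideProduct f v ιT) (hC : IsRigidCollar f v ν σ g s₁ s₂ ε₂ ιC aC bC)
    (hF : IsFoldTube f v ε ν) (hε : ε₂ ≤ ε) (hv0 : (v : 𝔼 3) 0 = 0) (hv1 : (v : 𝔼 3) 1 = 0)
    (ha : 0 < a) (had : 0 ≤ a + d) (hs₁ : s₁ ≤ (1 + 2 * (a + d) ^ 2)⁻¹) (hs₂ : (1 + 2 * a ^ 2)⁻¹ ≤ s₂)
    (hAeq : ∀ (θ : Fb) (w : 𝔼 2), a ≤ ‖w‖ → ‖w‖ < a + d → Acirc (θ, w) = toCircle (aC (ιT (θ, w))))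
    (u : 𝕊¹) (x : 𝔼 3) (z : X) (hx : x ∈ ball (0 : 𝔼 3) ε₂)
    (h1 : (1 + 2 * (a + d) ^ 2)⁻¹ < x 0 ^ 2 + x 1 ^ 2 - x 2 ^ 2)
    (h2 : x 0 ^ 2 + x 1 ^ 2 - x 2 ^ 2 < (1 + 2 * a ^ 2)⁻¹) (hfz : f z = f (ν (u, x)))
    (hAz : Aext ιT aC Acirc a d z = Aext ιT aC Acirc a d (ν (u, x))) :
    z ∈ ν '' ({u} ×ˢ ball (0 : 𝔼 3) ε₂) := by
  set s := x 0 ^ 2 + x 1 ^ 2 - x 2 ^ 2 with hsdef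
  have hxε : x ∈ ball (0 : 𝔼 3) ε := ball_subset_ball hε hx
  have hs1 : s₁ < s := lt_of_le_of_lt hs₁ h1
  have hs2 : s < s₂ := lt_of_lt_of_le h2 hs₂
  have hspos : 0 < s := lt_trans (by positivity) h1
  have hslt1 : s < 1 := lt_of_lt_of_le h2 (inv_le_one_of_one_le₀ (by nlinarith))
  have hssq : s ^ 2 < 1 := by nlinarith
  have hplanar : 0 < x 0 ^ 2 + x 1 ^ 2 := by
    have : 0 ≤ x 2 ^ 2 := sq_nonneg _
    linarith
  -- heights
  have hνh : hgt f v (ν (u, x)) = s := hgt_ν hF hv0 hv1 u hxε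
  have hzh : hgt f v z = s := by rw [hgt, hfz]; exact hνh
  -- `Aext = aC` at both points, so `aC z = aC (ν (u, x))`
  have hAν : Aext ιT aC Acirc a d (ν (u, x)) = aC (ν (u, x)) :=
    Aext_eq_aC_of_mem_shell hT hv0 hv1 ha.le had hAeq (by rw [hνh]; exact h1) (by rw [hνh]; exact h2)
  have hAzC : Aext ιT aC Acirc a d z = aC z :=
    Aext_eq_aC_of_mem_shell hT hv0 hv1 ha.le had hAeq (by rw [hzh]; exact h1) (by rw [hzh]; exact h2)
  have haC : aC z = aC (ν (u, x)) := by rw [← hAzC, hAz, hAν]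
  -- `z` in rigid coordinates with longitude `u`
  obtain ⟨eν0, eν1⟩ := f_ν_planar hF u hxε
  have hzsec : ιC ((aC z, bC z), (u, s)) = z :=
    ιC_section_pinned hC hzh hs1 hs2 hssq (by rw [hfz]; exact eν0) (by rw [hfz]; exact eν1)
  -- the level circle `c ↦ ν (u, levelPt x c)`
  have hmemε₂ : ∀ c, levelPt x c ∈ ball (0 : 𝔼 3) ε₂ := fun c ↦ by
    rw [mem_ball_zero_iff, norm_levelPt]; exact mem_ball_zero_iff.1 hx
  have hmemε : ∀ c, levelPt x c ∈ ball (0 : 𝔼 3) ε := fun c ↦ ball_subset_ball hε (hmemε₂ c)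
  have hQ : ∀ c, levelPt x c 0 ^ 2 + levelPt x c 1 ^ 2 - levelPt x c 2 ^ 2 = s := fun c ↦ Q_levelPt x c
  have hh : ∀ c, hgt f v (ν (u, levelPt x c)) = s := fun c ↦ by rw [hgt_ν hF hv0 hv1 u (hmemε c), hQ]
  have haCc : ∀ c, aC (ν (u, levelPt x c)) = aC z := fun c ↦ by
    rw [haC]
    apply Subtype.ext
    rw [hC.rigid u (levelPt x c) (hmemε₂ c) (by rw [hQ]; exact hs1) (by rw [hQ]; exact hs2),
      hC.rigid u x hx hs1 hs2, (levelPt_apply x c).2.2]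
  have hsec : ∀ c, ιC ((aC z, bC (ν (u, levelPt x c))), (u, s)) = ν (u, levelPt x c) := fun c ↦ by
    obtain ⟨e0, e1⟩ := f_ν_planar hF u (hmemε c)
    rw [hQ] at e0 e1
    rw [← haCc c]
    exact ιC_section_pinned hC (hh c) hs1 hs2 hssq e0 e1
  -- `c ↦ bC (ν (u, levelPt x c))` is continuous and injective, hence onto
  have hνc : Continuous fun c : 𝕊¹ ↦ ν (u, levelPt x c) :=
    hF.contMDiffOn.continuousOn.comp_continuous (continuous_const.prodMk (continuous_levelPt x))
      fun c ↦ ⟨mem_univ _, hmemε c⟩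
  have hφc : Continuous fun c : 𝕊¹ ↦ bC (ν (u, levelPt x c)) := by
    refine hC.contMDiffOn_bC.continuousOn.comp_continuous hνc fun c ↦ ?_
    change s₁ < hgt f v (ν (u, levelPt x c)) ∧ hgt f v (ν (u, levelPt x c)) < s₂
    rw [hh]
    exact ⟨hs1, hs2⟩
  have hφi : Injective fun c : 𝕊¹ ↦ bC (ν (u, levelPt x c)) := by
    intro c c' h
    dsimp only at h
    have h1c := hsec c
    rw [h] at h1c
    have h' : ν (u, levelPt x c) = ν (u, levelPt x c') := h1c.symm.trans (hsec c')
    have hm : ∀ c'', ((u, levelPt x c'') : 𝕊¹ × 𝔼 3) ∈ (univ : Set 𝕊¹) ×ˢ ball (0 : 𝔼 3) ε :=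
      fun c'' ↦ ⟨mem_univ _, hmemε c''⟩
    have h'' : ((u, levelPt x c) : 𝕊¹ × 𝔼 3) = (u, levelPt x c') := hF.injOn (hm c) (hm c') h'
    exact levelPt_injective hplanar (congrArg Prod.snd h'')
  obtain ⟨c, hc⟩ := surjective_of_continuous_of_injective_circle hφc hφi (bC z)
  dsimp only at hc
  refine ⟨(u, levelPt x c), ⟨rfl, hmemε₂ c⟩, ?_⟩
  have h1c := hsec c
  rw [hc, hzsec] at h1c
  exact h1c.symm

end Setup

end DiscExt

end Summit.SmoothPoincare4.SmoothPoincare4.Cruxes.RungOne.Sketch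

end
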